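import Summits.CriticalPhenomena.PercolationContinuityZ3.Theorems.Transplant.SkelNegParamsLatticeA
import Summits.CriticalPhenomena.PercolationContinuityZ3.Theorems.Transplant.SkelNegParamsFine
import HarnessLib

/-!
# N1 params, part Fine-A (q-free, consumer-independent): THE FINE WINDOW MAP WITH THE COARSE-LATTICE CONSTANT `A` AS A PARAMETER —
# **`Skelφ.NegPrm.fineA φ t A P n h ℓ v_α := fineSkel φ t A n h v_α v_β (20·K·s₀) (20·K·s₁) (D_A/2) (D_A/2) D_A`** (`D_A = DofA A n h ℓ v_α = A²·modulus`;
# the cells `P = ⟨K, s⟩`, resolution `c_i = 20·K·s_i` per lattice cell, unchanged) with its five facts: base point, 1-Lipschitz, weak steps, kit-drift reading,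
# φ-extent of a fine box (stmt-g16 2026-08-22; (ζ′), twin of `SkelNegParamsFine` p27xxxx with `800 ↦ A`; `fine = fineA 800` by `rfl`)
At `A := 20·K` (the (ζ′) chain) `c_i = A·s_i`: one lattice period `u` reads as `s_i` fine cells ('κ₀ := s∥').
builds on p205010 (kernel theorem, internal audit signed; external expert review pending) — nothing in this file uses p205010; NOTHING is claimed about the node
`SamePDropOfSkeletonNeg₁` (OPEN).
Lane `prim-bschramm-*`, seat `prim-bschramm-stmt` (gen 16); helper file (`--supports stmt-CriticalPhenomena-4575 --as helper`); ledger HOME/prim-bschramm-stmt/NEG-PARAMS.md.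
* §1 **`fineA`**, `fineA_eq`, `fine_eq_fineA`, `fineA_apply`; §2 **`fineA_base`**, **`lip_fineA`**, **`weakSteps_fineA`**, **`fineA_drift_le`**, **`φ_extent_of_fineA_extent`**
  (`10·K·|Δφ_i| ≤ A·(n + ℓ + 3|h| + 1)·(r + 1)`).
[cite: MartineauTassion2017, §4.1–4.3 (the cell lattice generated by u and v)] [cite: KozmaNitzan2024, §4 pp. 25–26 (two-unit cells), Lemma 10 Step IV]
-/

namespace Summit.CriticalPhenomena.PercolationContinuityZ3.Theorems.Transplant

namespace Skelφ

namespace NegPrm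

open Literature.Probability.LatticeModels
open TwoAxis.Para (lam0 lam1)

variable {V : Type} {G : SimpleGraph V}

/-! ## §1 The fine window map at lattice constant `A` -/

/-- **THE FINE WINDOW MAP AT LATTICE CONSTANT `A`**: the fine cell-aligned skeleton of the cell lattice `[A·u A·v]` (`u = (n, h)`, `v = (v_α, v_β)`,
`v_β := vβOf n h ℓ v_α`, `D_A := DofA A n h ℓ v_α`) with resolution `c_i := 20·K·s_i` per lattice cell and nearest-cell rounding. [this work] -/
def fineA (φ : V → Site 2) (t : V) (A : ℤ) (P : PCells2) (n : ℕ) (h : ℤ) (ℓ : ℕ) (vα : ℤ) : V → Site 2 :=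
  fineSkel φ t A n h vα (vβOf n h ℓ vα) (20 * (P.K : ℤ) * (P.s 0 : ℤ)) (20 * (P.K : ℤ) * (P.s 1 : ℤ))
    (DofA A n h ℓ vα / 2) (DofA A n h ℓ vα / 2) (DofA A n h ℓ vα)

/-- `fineA` unfolded. [folklore] -/
theorem fineA_eq (φ : V → Site 2) (t : V) (A : ℤ) (P : PCells2) (n : ℕ) (h : ℤ) (ℓ : ℕ) (vα : ℤ) :
    fineA φ t A P n h ℓ vα = fineSkel φ t A n h vα (vβOf n h ℓ vα) (20 * (P.K : ℤ) * (P.s 0 : ℤ)) (20 * (P.K : ℤ) * (P.s 1 : ℤ))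
      (DofA A n h ℓ vα / 2) (DofA A n h ℓ vα / 2) (DofA A n h ℓ vα) := rfl

/-- The ledger's `fine` is `fineA 800`. [folklore] -/
theorem fine_eq_fineA (φ : V → Site 2) (t : V) (P : PCells2) (n : ℕ) (h : ℤ) (ℓ : ℕ) (vα : ℤ) : fine φ t P n h ℓ vα = fineA φ t 800 P n h ℓ vα := rfl

/-- The two fine coordinates: `fineA_i = ⌊(c_i·λ_i + D_A/2)/D_A⌋` of the relative position. [folklore] -/
theorem fineA_apply (φ : V → Site 2) (t : V) (A : ℤ) (P : PCells2) (n : ℕ) (h : ℤ) (ℓ : ℕ) (vα : ℤ) (w : V) :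
    fineA φ t A P n h ℓ vα w 0 =
        TwoAxis.Para.coarse (20 * (P.K : ℤ) * (P.s 0 : ℤ)) (DofA A n h ℓ vα / 2) (DofA A n h ℓ vα) (lam0 A vα (vβOf n h ℓ vα) (relφ φ t w)) ∧
      fineA φ t A P n h ℓ vα w 1 =
        TwoAxis.Para.coarse (20 * (P.K : ℤ) * (P.s 1 : ℤ)) (DofA A n h ℓ vα / 2) (DofA A n h ℓ vα) (lam1 A n h (relφ φ t w)) :=
  ⟨rfl, rfl⟩

/-! ## §2 The five facts -/

/-- **BASE POINT**: `fineA … t = 0` (`A ≠ 0`, `1 ≤ n`, `1 ≤ ℓ`). [folklore] -/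
theorem fineA_base (φ : V → Site 2) (t : V) {A : ℤ} (hA : A ≠ 0) (P : PCells2) {n ℓ : ℕ} (hn : 1 ≤ n) (hℓ : 1 ≤ ℓ) (h vα : ℤ) :
    fineA φ t A P n h ℓ vα t = 0 := by
  have hD := DofA_pos hA hn hℓ h vα
  have hrel : relφ φ t t = 0 := by funext i; simp
  have h0 : ∀ c : ℤ, TwoAxis.Para.coarse c (DofA A n h ℓ vα / 2) (DofA A n h ℓ vα) 0 = 0 := by
    intro c
    unfold TwoAxis.Para.coarse
    rw [mul_zero, zero_add]
    refine Int.ediv_eq_zero_of_lt (Int.ediv_nonneg hD.le (by norm_num)) ?_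
    rw [Int.ediv_lt_iff_lt_mul (by norm_num : (0 : ℤ) < 2)]
    linarith
  have hl0 : lam0 A vα (vβOf n h ℓ vα) 0 = 0 := by simp [TwoAxis.Para.lam0]
  have hl1 : lam1 A (n : ℤ) h 0 = 0 := by simp [TwoAxis.Para.lam1, TwoAxis.Para.bp]
  funext i
  fin_cases i
  · show fineA φ t A P n h ℓ vα t 0 = 0
    rw [(fineA_apply φ t A P n h ℓ vα t).1, hrel, hl0, h0]
  · show fineA φ t A P n h ℓ vα t 1 = 0
    rw [(fineA_apply φ t A P n h ℓ vα t).2, hrel, hl1, h0]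

/-- **THE FINE MAP IS 1-LIPSCHITZ** from the two resolution inequalities `c_i·L_i ≤ D_A` (`NegPrm.cL_le_DA₀/₁`; `A ≠ 0`). [cite: MartineauTassion2017, §4.3] -/
theorem lip_fineA {φ : V → Site 2} (hlip : Lip G φ) (t : V) {A : ℤ} (hA : A ≠ 0) (P : PCells2) {n ℓ : ℕ} (hn : 1 ≤ n) (hℓ : 1 ≤ ℓ) {h vα : ℤ}
    (hL0 : 20 * (P.K : ℤ) * (P.s 0 : ℤ) * (|A| * (|vβOf n h ℓ vα| + |vα|)) ≤ DofA A n h ℓ vα)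
    (hL1 : 20 * (P.K : ℤ) * (P.s 1 : ℤ) * (|A| * (|(n : ℤ)| + |h|)) ≤ DofA A n h ℓ vα) :
    Lip G (fineA φ t A P n h ℓ vα) := by
  rw [fineA_eq]
  exact lip_fineSkel hlip t (c_nonneg P 0) (c_nonneg P 1) (DofA_pos hA hn hℓ h vα) hL0 hL1

/-- **THE FINE MAP HAS WEAK STEPS** from unit steps of `φ` alone (`A ≠ 0`, `1 ≤ n`, `1 ≤ ℓ`). [this work] -/
theorem weakSteps_fineA {φ : V → Site 2} (hstep : Steps G φ) (t : V) {A : ℤ} (hA : A ≠ 0) (P : PCells2) {n ℓ : ℕ} (hn : 1 ≤ n) (hℓ : 1 ≤ ℓ)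
    (h vα : ℤ) : WeakSteps G (fineA φ t A P n h ℓ vα) := by
  rw [fineA_eq]
  exact weakSteps_fineSkel hstep t (DofA_pos hA hn hℓ h vα) (c_nonneg P 0) (c_nonneg P 1)

/-- **KIT DRIFT READS AS AT MOST `s` FINE UNITS** from the two resolution inequalities (`A ≠ 0`). [cite: KozmaNitzan2024, §4 Lemma 10 Step IV] -/
theorem fineA_drift_le (t : V) {A : ℤ} (hA : A ≠ 0) (P : PCells2) {n ℓ : ℕ} (hn : 1 ≤ n) (hℓ : 1 ≤ ℓ) {h vα : ℤ}
    (hL0 : 20 * (P.K : ℤ) * (P.s 0 : ℤ) * (|A| * (|vβOf n h ℓ vα| + |vα|)) ≤ DofA A n h ℓ vα)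
    (hL1 : 20 * (P.K : ℤ) * (P.s 1 : ℤ) * (|A| * (|(n : ℤ)| + |h|)) ≤ DofA A n h ℓ vα) {s : ℤ} (hs : 0 ≤ s) {φ : V → Site 2} {w w' : V}
    (h0 : |φ w 0 - φ w' 0| ≤ s) (h1 : |φ w 1 - φ w' 1| ≤ s) (i : Fin 2) :
    |fineA φ t A P n h ℓ vα w i - fineA φ t A P n h ℓ vα w' i| ≤ s := by
  have hD := DofA_pos hA hn hℓ h vα
  have hL0' : 20 * (P.K : ℤ) * (P.s 0 : ℤ) * (|A| * (|vβOf n h ℓ vα| + |vα|) * s) ≤ s * DofA A n h ℓ vα := by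
    calc 20 * (P.K : ℤ) * (P.s 0 : ℤ) * (|A| * (|vβOf n h ℓ vα| + |vα|) * s)
        = 20 * (P.K : ℤ) * (P.s 0 : ℤ) * (|A| * (|vβOf n h ℓ vα| + |vα|)) * s := by ring
      _ ≤ DofA A n h ℓ vα * s := mul_le_mul_of_nonneg_right hL0 hs
      _ = s * DofA A n h ℓ vα := mul_comm _ _
  have hL1' : 20 * (P.K : ℤ) * (P.s 1 : ℤ) * (|A| * (|(n : ℤ)| + |h|) * s) ≤ s * DofA A n h ℓ vα := by
    calc 20 * (P.K : ℤ) * (P.s 1 : ℤ) * (|A| * (|(n : ℤ)| + |h|) * s)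
        = 20 * (P.K : ℤ) * (P.s 1 : ℤ) * (|A| * (|(n : ℤ)| + |h|)) * s := by ring
      _ ≤ DofA A n h ℓ vα * s := mul_le_mul_of_nonneg_right hL1 hs
      _ = s * DofA A n h ℓ vα := mul_comm _ _
  have key := fine_containment (φ := φ) t (s₀ := DofA A n h ℓ vα / 2) (s₁ := DofA A n h ℓ vα / 2) hD (c_nonneg P 0) (c_nonneg P 1) hL0' hL1' h0 h1
  rw [fineA_eq]
  fin_cases i
  · exact key.1
  · exact key.2

/-- **A FINE BOX IS A φ-BOX, any `A > 0`**: fine positions at distance `≤ r` in each coordinate give `10·K·|Δφ_i| ≤ A·(n + ℓ + 3|h| + 1)·(r + 1)` for both planar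
coordinates (`1 ≤ n`, `1 ≤ ℓ`, `|v_α| ≤ n`; the resolutions are `≥ 20K`; at `A = 800` this is today's `K·|Δφ_i| ≤ 80·(…)·(r+1)`).
[cite: KozmaNitzan2024, §4 Lemma 12 (p. 24: the planar size of a window)] -/
theorem φ_extent_of_fineA_extent {φ : V → Site 2} (t : V) {A : ℤ} (hA : 0 < A) (P : PCells2) {n ℓ : ℕ} (hn : 1 ≤ n) (hℓ : 1 ≤ ℓ) (h : ℤ) {vα : ℤ}
    (hv : |vα| ≤ (n : ℤ)) {w w' : V} {r : ℤ} (hr : 0 ≤ r) (hρ : ∀ i, |fineA φ t A P n h ℓ vα w i - fineA φ t A P n h ℓ vα w' i| ≤ r) (i : Fin 2) :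
    10 * (P.K : ℤ) * |φ w i - φ w' i| ≤ A * ((n : ℤ) + ℓ + 3 * |h| + 1) * (r + 1) := by
  have hD : 0 < DofA A n h ℓ vα := DofA_pos hA.ne' hn hℓ h vα
  have hvβ : |vβOf n h ℓ vα| ≤ (ℓ : ℤ) + 2 * |h| + 1 :=
    abs_vβ_le (by exact_mod_cast hn) (by positivity) hv (modulus_vβOf_layer hn h ℓ vα)
  have h0 := hρ 0
  have h1 := hρ 1
  rw [(fineA_apply φ t A P n h ℓ vα w).1, (fineA_apply φ t A P n h ℓ vα w').1] at h0
  rw [(fineA_apply φ t A P n h ℓ vα w).2, (fineA_apply φ t A P n h ℓ vα w').2] at h1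
  have hc : (0 : ℤ) ≤ 20 * (P.K : ℤ) := by positivity
  obtain ⟨e0, e1⟩ := TwoAxis.Para.abs_sub_le_of_fine (A := A) (n := (n : ℤ)) (h := h) (vα := vα) (vβ := vβOf n h ℓ vα) hc
    (twentyK_le_c P 0) (twentyK_le_c P 1) hD h0 h1
  have hx0 : relφ φ t w 0 - relφ φ t w' 0 = φ w 0 - φ w' 0 := by simp
  have hx1 : relφ φ t w 1 - relφ φ t w' 1 = φ w 1 - φ w' 1 := by simp
  rw [hx0] at e0
  rw [hx1] at e1
  have eA : |A| = A := abs_of_pos hA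
  have en : |(n : ℤ)| = n := abs_of_nonneg (by positivity)
  rw [eA, en] at e0
  rw [eA] at e1
  have hA0 := hA.le
  fin_cases i
  · have hφ := abs_nonneg (φ w 0 - φ w' 0)
    show 10 * (P.K : ℤ) * |φ w 0 - φ w' 0| ≤ A * ((n : ℤ) + ℓ + 3 * |h| + 1) * (r + 1)
    have hb : A * ((n : ℤ) + |vα|) * (r + 1) ≤ A * (2 * ((n : ℤ) + ℓ + 3 * |h| + 1)) * (r + 1) := by
      have : (n : ℤ) + |vα| ≤ 2 * ((n : ℤ) + ℓ + 3 * |h| + 1) := by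
        have hℓ0 : (0 : ℤ) ≤ ℓ := by positivity
        linarith [abs_nonneg h, abs_nonneg vα]
      have hr1 : 0 ≤ r + 1 := by linarith
      exact mul_le_mul_of_nonneg_right (mul_le_mul_of_nonneg_left this hA0) hr1
    nlinarith [hφ]
  · have hφ := abs_nonneg (φ w 1 - φ w' 1)
    show 10 * (P.K : ℤ) * |φ w 1 - φ w' 1| ≤ A * ((n : ℤ) + ℓ + 3 * |h| + 1) * (r + 1)
    have hb : A * (|h| + |vβOf n h ℓ vα|) * (r + 1) ≤ A * ((n : ℤ) + ℓ + 3 * |h| + 1) * (r + 1) := by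
      have : |h| + |vβOf n h ℓ vα| ≤ (n : ℤ) + ℓ + 3 * |h| + 1 := by nlinarith [abs_nonneg h, abs_nonneg (vβOf n h ℓ vα)]
      have hr1 : 0 ≤ r + 1 := by linarith
      exact mul_le_mul_of_nonneg_right (mul_le_mul_of_nonneg_left this hA0) hr1
    nlinarith [hφ]

end NegPrm

end Skelφ

end Summit.CriticalPhenomena.PercolationContinuityZ3.Theorems.Transplant
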